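import Literature.Analysis.FluidPDE.ForwardDSSLocalLeray
import HarnessLib

/-!
# [BT1] §4: the pressure class of an ansatz pair up to `t = 0`

Analysis/FluidPDE proof file (theorems only) in the decomposition of
`Literature.Analysis.FluidPDE.bradshawTsai2017_dss_localLeray_existence` ([BT1] Thm 1.2): the
clause `π ∈ L^{3/2}_loc(ℝ³ × [0,∞))` of [BT1] Def. 1.1 (`IsLocalLeraySolution.pressure`) for an
ansatz pair (`BradshawTsai2017.IsAnsatzSolution`, `ForwardDSSLocalLeray`). As explained in the
module docstring of `ForwardDSSLocalLeray` ("The pressure class"), §4 of [BT1] is silent on this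
clause; it follows from the printed class `p ∈ L^{5/3}(ℝ³ × [0,T])` of the proof of Thm 2.4
(field `pressure_five_thirds`) and the `λ`-DSS scaling of the pressure:

1. `setLIntegral_shell_eq`: `∫∫_{(λ^{-2(k+1)}, λ^{-2k}] × B₁} |π|^{3/2} = λ^{-2k} ∫∫_{(λ⁻²,1] × B_{λᵏ}} |π|^{3/2}`
   (`λ² π(λ²t, λx) = π(t,x)` and the change of variables of `SpaceTimeRescaling`);
2. `rpow_three_halves_le`: the interpolated Young inequality `x^{3/2} ≤ m⁻¹x^{5/3} + m⁹` with
   `m = λ^{-k}`, integrated over `(λ⁻², 1] × B_{λᵏ}` (volume `≤ λ^{3k}|B₁|`), gives the shell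
   estimate `setLIntegral_shell_le`: `… ≤ λ^{-k}(A + |B₁|)`, `A = ∫∫_{(λ⁻²,1]×ℝ³} |π|^{5/3} < ∞`;
3. the shells cover `(0,1)` (`Ioo_subset_iUnion_shell`), the geometric series converges
   (`setLIntegral_unitCylinder_three_halves_lt_top`), and the tree's transport along the scaling
   (`BradshawTsai2019.setLIntegral_enorm_rpow_lt_top_of_dss`) gives every `(0,T) × K`
   (`IsAnsatzSolution.pressure`).

(An exponent-free variant of the Hölder step `λ^{-2k}·λ^{3k/10}` of the design note; any
`m = λ^{-ak}` with `1/3 < a < 6` works, `a = 1` keeps all powers integral.)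

## References

* Z. Bradshaw, T.-P. Tsai, Ann. Henri Poincaré 18 (2017) = arXiv:1510.07504, Def. 1.1, proof of
  Thm 2.4 ("`p ∈ L^{5/3}(ℝ³ × [0,T])`"), §4 [BradshawTsai2017AHP].
-/

noncomputable section

open MeasureTheory Set Function Filter Topology TopologicalSpace Metric Module
open scoped NNReal ENNReal InnerProductSpace RealInnerProductSpace

namespace Literature.Analysis.FluidPDE

namespace BradshawTsai2017

/-- Local notation for physical space `ℝ³ = EuclideanSpace ℝ (Fin 3)`. -/
local notation "ℝ³" => EuclideanSpace ℝ (Fin 3)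

variable {c : ℝ} {v₀ : ℝ³ → ℝ³} {v : ℝ → ℝ³ → ℝ³} {π : ℝ → ℝ³ → ℝ}

/-! ### Elementary pieces -/

/-- Preimage of a half-open time slab `(a, b] × S` under the parabolic scaling
`(s, y) ↦ (β s, γ y)` (`β > 0`). [folklore] -/
theorem stAffine_preimage_Ioc_prod {β : ℝ} (hβ : 0 < β) (γ a b : ℝ) (S : Set ℝ³) :
    stAffine β γ 0 (0 : ℝ³) ⁻¹' (Ioc a b ×ˢ S) =
      Ioc (a / β) (b / β) ×ˢ ((fun y : ℝ³ => (0 : ℝ³) + γ • y) ⁻¹' S) := by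
  ext ⟨s, y⟩
  simp only [mem_preimage, stAffine_apply, mem_prod, mem_Ioc, zero_add]
  rw [div_lt_iff₀ hβ, le_div_iff₀ hβ, mul_comm s β]

/-- **Interpolated Young inequality** `x^{3/2} ≤ m⁻¹ x^{5/3} + m⁹` in `ℝ≥0∞` (`0 < m < ∞`): for
`x ≤ m⁶` the left side is at most `(m⁶)^{3/2} = m⁹`, otherwise
`x^{3/2} = x^{5/3} x^{-1/6} ≤ x^{5/3} (m⁶)^{-1/6}`. [folklore] -/
theorem rpow_three_halves_le (x : ℝ≥0∞) {m : ℝ≥0∞} (hmt : m ≠ ⊤) :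
    x ^ (3 / 2 : ℝ) ≤ m⁻¹ * x ^ (5 / 3 : ℝ) + m ^ 9 := by
  have h6 : (m ^ 6) ^ (1 / 6 : ℝ) = m := by
    rw [← ENNReal.rpow_natCast m 6, ← ENNReal.rpow_mul]; norm_num
  rcases le_or_gt x (m ^ 6) with hx | hx
  · calc x ^ (3 / 2 : ℝ) ≤ (m ^ 6) ^ (3 / 2 : ℝ) := ENNReal.rpow_le_rpow hx (by norm_num)
      _ = m ^ 9 := by
          rw [← ENNReal.rpow_natCast m 6, ← ENNReal.rpow_mul, ← ENNReal.rpow_natCast m 9]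
          norm_num
      _ ≤ m⁻¹ * x ^ (5 / 3 : ℝ) + m ^ 9 := le_add_self
  · rcases eq_or_ne x ⊤ with rfl | hxt
    · rw [ENNReal.top_rpow_of_pos (by norm_num : (0 : ℝ) < 5 / 3), ENNReal.mul_top
        (ENNReal.inv_ne_zero.2 hmt)]
      exact le_top.trans le_self_add
    · have hx0 : x ≠ 0 := by rintro rfl; simp at hx
      have hsplit : x ^ (3 / 2 : ℝ) = x ^ (5 / 3 : ℝ) * (x ^ (1 / 6 : ℝ))⁻¹ := by
        rw [← ENNReal.rpow_neg, ← ENNReal.rpow_add _ _ hx0 hxt]; norm_num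
      have hinv : (x ^ (1 / 6 : ℝ))⁻¹ ≤ m⁻¹ := by
        rw [ENNReal.inv_le_inv, ← h6]
        exact ENNReal.rpow_le_rpow hx.le (by norm_num)
      calc x ^ (3 / 2 : ℝ) = x ^ (5 / 3 : ℝ) * (x ^ (1 / 6 : ℝ))⁻¹ := hsplit
        _ ≤ x ^ (5 / 3 : ℝ) * m⁻¹ := mul_le_mul_right hinv _
        _ = m⁻¹ * x ^ (5 / 3 : ℝ) := mul_comm _ _
        _ ≤ m⁻¹ * x ^ (5 / 3 : ℝ) + m ^ 9 := le_self_add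

/-- Integrated form: `∫_S f^{3/2} ≤ m⁻¹ ∫_S f^{5/3} + m⁹ |S|`. [folklore] -/
theorem setLIntegral_rpow_three_halves_le (f : ℝ × ℝ³ → ℝ≥0∞) (S : Set (ℝ × ℝ³)) {m : ℝ≥0∞}
    (hm0 : m ≠ 0) (hmt : m ≠ ⊤) :
    ∫⁻ z in S, f z ^ (3 / 2 : ℝ) ≤ m⁻¹ * (∫⁻ z in S, f z ^ (5 / 3 : ℝ)) + m ^ 9 * volume S := by
  calc ∫⁻ z in S, f z ^ (3 / 2 : ℝ) ≤ ∫⁻ z in S, (m⁻¹ * f z ^ (5 / 3 : ℝ) + m ^ 9) :=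
        lintegral_mono fun z => rpow_three_halves_le (f z) hmt
    _ = m⁻¹ * (∫⁻ z in S, f z ^ (5 / 3 : ℝ)) + m ^ 9 * volume S := by
        rw [lintegral_add_right _ measurable_const, lintegral_const_mul' _ _
          (ENNReal.inv_ne_top.2 hm0), setLIntegral_const]

/-- The scaling constant of the `L^{3/2}`-class of a DSS pressure: `(γ²)^{3/2} (γ² γ³)⁻¹ = γ⁻²`. [folklore] -/
theorem enorm_sq_rpow_three_halves_mul {γ : ℝ} (hγ : 0 < γ) :
    ‖γ ^ 2‖ₑ ^ (3 / 2 : ℝ) * ENNReal.ofReal (γ * γ * γ ^ finrank ℝ ℝ³)⁻¹ =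
      ENNReal.ofReal (γ⁻¹ ^ 2) := by
  have h1 : (γ ^ 2) ^ (3 / 2 : ℝ) = γ ^ 3 := by
    rw [← Real.rpow_natCast γ 2, ← Real.rpow_mul hγ.le, ← Real.rpow_natCast γ 3]; norm_num
  rw [Real.enorm_eq_ofReal (sq_nonneg γ), ENNReal.ofReal_rpow_of_nonneg (sq_nonneg γ) (by norm_num),
    h1, finrank_euclideanSpace_fin, ← ENNReal.ofReal_mul (by positivity)]
  congr 1
  field_simp

/-! ### The `L^{5/3}` class one period down, and the shell integrals -/

/-- `π ∈ L^{5/3}((λ⁻², 1] × ℝ³)`: the printed class `π ∈ L^{5/3}((1, λ²) × ℝ³)` transported one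
period down the scaling (`λ² π(λ²t, λx) = π(t, x)`). [cite: BradshawTsai2017AHP, §4 (proof of Thm 1.2)] -/
theorem IsAnsatzSolution.setLIntegral_Ioc_five_thirds_lt_top (h : IsAnsatzSolution c v₀ v π)
    (hc : 1 < c) :
    ∫⁻ z in Ioc (c ^ 2)⁻¹ 1 ×ˢ (univ : Set ℝ³), ‖π z.1 z.2‖ₑ ^ (5 / 3 : ℝ) < ⊤ := by
  have hc0 : 0 < c := zero_lt_one.trans hc
  -- the printed class on the half-open period `(1, λ²]`
  have hP : ∫⁻ z in Ioc 1 (c ^ 2) ×ˢ (univ : Set ℝ³), ‖π z.1 z.2‖ₑ ^ (5 / 3 : ℝ) < ⊤ := by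
    have hae : (Ioo (1 : ℝ) (c ^ 2) ×ˢ (univ : Set ℝ³) : Set (ℝ × ℝ³)) =ᵐ[volume]
        (Ioc (1 : ℝ) (c ^ 2) ×ˢ (univ : Set ℝ³) : Set (ℝ × ℝ³)) := by
      rw [Measure.volume_eq_prod]
      exact Measure.set_prod_ae_eq Ioo_ae_eq_Ioc EventuallyEq.rfl
    rw [← Measure.restrict_congr_set hae]
    exact h.pressure_five_thirds
  have key := setLIntegral_enorm_rpow_stRescale (E := ℝ³) (F := ℝ) (mul_pos hc0 hc0) hc0 0
    (0 : ℝ³) (c ^ 2) π (Ioc 1 (c ^ 2) ×ˢ (univ : Set ℝ³)) (by norm_num : (0 : ℝ) ≤ 5 / 3)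
  rw [BradshawTsai2019.sq_smul_stPull_eq_self h.dss_pressure,
    stAffine_preimage_Ioc_prod (mul_pos hc0 hc0), preimage_univ] at key
  have hset : Ioc (1 / (c * c)) (c ^ 2 / (c * c)) = Ioc (c ^ 2)⁻¹ (1 : ℝ) := by
    rw [one_div, ← sq, div_self (pow_ne_zero 2 hc0.ne')]
  rw [hset] at key
  rw [key]
  exact ENNReal.mul_lt_top (ENNReal.mul_lt_top
    (ENNReal.rpow_lt_top_of_nonneg (by norm_num) enorm_ne_top) ENNReal.ofReal_lt_top) hP

/-- **Scaling of the shell integrals**: for a `λ`-DSS pressure and `γ = λᵏ`,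
`∫∫_{(γ⁻²a, γ⁻²b] × B₁} |π|^{3/2} = γ⁻² ∫∫_{(a, b] × B_γ} |π|^{3/2}`. [cite: BradshawTsai2017AHP, §4 (proof of Thm 1.2)] -/
theorem setLIntegral_shell_eq {p : ℝ → ℝ³ → ℝ} {γ : ℝ} (hγ : 0 < γ)
    (hp : FluidPDE.nsRescalePressure γ p = p) (a b : ℝ) :
    ∫⁻ z in Ioc (a / (γ * γ)) (b / (γ * γ)) ×ˢ ball (0 : ℝ³) 1, ‖p z.1 z.2‖ₑ ^ (3 / 2 : ℝ) =
      ENNReal.ofReal (γ⁻¹ ^ 2) *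
        ∫⁻ z in Ioc a b ×ˢ ball (0 : ℝ³) γ, ‖p z.1 z.2‖ₑ ^ (3 / 2 : ℝ) := by
  have key := setLIntegral_enorm_rpow_stRescale (E := ℝ³) (F := ℝ) (mul_pos hγ hγ) hγ 0
    (0 : ℝ³) (γ ^ 2) p (Ioc a b ×ˢ ball (0 : ℝ³) γ) (by norm_num : (0 : ℝ) ≤ 3 / 2)
  rw [BradshawTsai2019.sq_smul_stPull_eq_self hp, stAffine_preimage_Ioc_prod (mul_pos hγ hγ),
    space_affine_preimage_ball hγ, sub_zero, smul_zero, div_self hγ.ne',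
    enorm_sq_rpow_three_halves_mul hγ] at key
  exact key

/-- **The shell estimate.** For an ansatz pair, `k ∈ ℕ` and `γ = λᵏ`:
`∫∫_{(λ^{-2(k+1)}, λ^{-2k}] × B₁} |π|^{3/2} ≤ λ^{-k} (A + |B₁|)` with
`A = ∫∫_{(λ⁻²,1] × ℝ³} |π|^{5/3}` (scaling to `(λ⁻², 1] × B_γ`, the interpolated Young inequality
with `m = γ⁻¹`, and `|(λ⁻²,1] × B_γ| ≤ γ³ |B₁|`). [cite: BradshawTsai2017AHP, §4 (proof of Thm 1.2)] -/
theorem IsAnsatzSolution.setLIntegral_shell_le (h : IsAnsatzSolution c v₀ v π) (hc : 1 < c)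
    (k : ℕ) :
    ∫⁻ z in Ioc ((c ^ 2) ^ (k + 1))⁻¹ ((c ^ 2) ^ k)⁻¹ ×ˢ ball (0 : ℝ³) 1,
        ‖π z.1 z.2‖ₑ ^ (3 / 2 : ℝ) ≤
      ENNReal.ofReal c⁻¹ ^ k *
        ((∫⁻ z in Ioc (c ^ 2)⁻¹ 1 ×ˢ (univ : Set ℝ³), ‖π z.1 z.2‖ₑ ^ (5 / 3 : ℝ)) +
          volume (ball (0 : ℝ³) 1)) := by
  have hc0 : 0 < c := zero_lt_one.trans hc
  set γ : ℝ := c ^ k with hγ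
  have hγ0 : 0 < γ := pow_pos hc0 k
  have hγ1 : 1 ≤ γ := one_le_pow₀ hc.le
  set A := ∫⁻ z in Ioc (c ^ 2)⁻¹ 1 ×ˢ (univ : Set ℝ³), ‖π z.1 z.2‖ₑ ^ (5 / 3 : ℝ) with hA
  -- rewrite the shell as the scaled image of `(λ⁻², 1] × B_γ`
  have hset : Ioc ((c ^ 2) ^ (k + 1))⁻¹ ((c ^ 2) ^ k)⁻¹ =
      Ioc ((c ^ 2)⁻¹ / (γ * γ)) (1 / (γ * γ)) := by
    have h1 : (c ^ 2) ^ (k + 1) = c ^ 2 * (γ * γ) := by rw [hγ]; ring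
    have h2 : (c ^ 2) ^ k = γ * γ := by rw [hγ]; ring
    rw [h1, h2, mul_inv, div_eq_mul_inv, one_div]
  rw [hset, setLIntegral_shell_eq hγ0 (BradshawTsai2019.nsRescalePressure_pow_eq h.dss_pressure k)]
  -- interpolate on `(λ⁻², 1] × B_γ` with `m = γ⁻¹`
  have hm0 : ENNReal.ofReal γ⁻¹ ≠ 0 := (ENNReal.ofReal_pos.2 (inv_pos.2 hγ0)).ne'
  have hI := setLIntegral_rpow_three_halves_le (fun z : ℝ × ℝ³ => ‖π z.1 z.2‖ₑ)
    (Ioc (c ^ 2)⁻¹ 1 ×ˢ ball (0 : ℝ³) γ) hm0 ENNReal.ofReal_ne_top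
  have hvol : volume (Ioc (c ^ 2)⁻¹ (1 : ℝ) ×ˢ ball (0 : ℝ³) γ) ≤
      ENNReal.ofReal (γ ^ 3) * volume (ball (0 : ℝ³) 1) := by
    rw [Measure.volume_eq_prod, Measure.prod_prod, Measure.addHaar_ball_of_pos _ _ hγ0,
      finrank_euclideanSpace_fin, Real.volume_Ioc]
    calc ENNReal.ofReal (1 - (c ^ 2)⁻¹) * (ENNReal.ofReal (γ ^ 3) * volume (ball (0 : ℝ³) 1))
        ≤ 1 * (ENNReal.ofReal (γ ^ 3) * volume (ball (0 : ℝ³) 1)) := by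
          refine mul_le_mul_left ?_ _
          rw [← ENNReal.ofReal_one]
          exact ENNReal.ofReal_le_ofReal (by linarith [inv_nonneg.2 (sq_nonneg c)])
      _ = _ := one_mul _
  have hA5 : ∫⁻ z in Ioc (c ^ 2)⁻¹ 1 ×ˢ ball (0 : ℝ³) γ, ‖π z.1 z.2‖ₑ ^ (5 / 3 : ℝ) ≤ A :=
    lintegral_mono_set (prod_mono Subset.rfl (subset_univ _))
  -- real arithmetic of the constants
  have hr : ENNReal.ofReal c⁻¹ ^ k = ENNReal.ofReal γ⁻¹ := by
    rw [← ENNReal.ofReal_pow (inv_nonneg.2 hc0.le), hγ, inv_pow]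
  have e1 : ENNReal.ofReal (γ⁻¹ ^ 2) * (ENNReal.ofReal γ⁻¹)⁻¹ = ENNReal.ofReal γ⁻¹ := by
    rw [← ENNReal.ofReal_inv_of_pos (inv_pos.2 hγ0), inv_inv, ← ENNReal.ofReal_mul (by positivity)]
    congr 1
    field_simp
  have e2 : ENNReal.ofReal (γ⁻¹ ^ 2) * (ENNReal.ofReal γ⁻¹ ^ 9 * ENNReal.ofReal (γ ^ 3)) ≤
      ENNReal.ofReal γ⁻¹ := by
    rw [← ENNReal.ofReal_pow (inv_nonneg.2 hγ0.le), ← ENNReal.ofReal_mul (by positivity),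
      ← ENNReal.ofReal_mul (by positivity)]
    refine ENNReal.ofReal_le_ofReal ?_
    have : γ⁻¹ ^ 2 * (γ⁻¹ ^ 9 * γ ^ 3) = γ⁻¹ ^ 8 := by field_simp
    rw [this]
    exact pow_le_of_le_one (inv_nonneg.2 hγ0.le) (inv_le_one_of_one_le₀ hγ1) (by norm_num)
  calc ENNReal.ofReal (γ⁻¹ ^ 2) *
        ∫⁻ z in Ioc (c ^ 2)⁻¹ 1 ×ˢ ball (0 : ℝ³) γ, ‖π z.1 z.2‖ₑ ^ (3 / 2 : ℝ)
      ≤ ENNReal.ofReal (γ⁻¹ ^ 2) * ((ENNReal.ofReal γ⁻¹)⁻¹ * A +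
          ENNReal.ofReal γ⁻¹ ^ 9 * (ENNReal.ofReal (γ ^ 3) * volume (ball (0 : ℝ³) 1))) := by
        refine mul_le_mul_right (hI.trans (add_le_add (mul_le_mul_right hA5 _)
          (mul_le_mul_right hvol _))) _
    _ = ENNReal.ofReal (γ⁻¹ ^ 2) * (ENNReal.ofReal γ⁻¹)⁻¹ * A +
          ENNReal.ofReal (γ⁻¹ ^ 2) * (ENNReal.ofReal γ⁻¹ ^ 9 * ENNReal.ofReal (γ ^ 3)) *
            volume (ball (0 : ℝ³) 1) := by ring
    _ ≤ ENNReal.ofReal γ⁻¹ * A + ENNReal.ofReal γ⁻¹ * volume (ball (0 : ℝ³) 1) := by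
        rw [e1]; exact add_le_add le_rfl (mul_le_mul_left e2 _)
    _ = ENNReal.ofReal c⁻¹ ^ k * (A + volume (ball (0 : ℝ³) 1)) := by rw [hr, mul_add]

/-- The shells `(λ^{-2(k+1)}, λ^{-2k}]`, `k ∈ ℕ`, cover `(0, 1)`. [folklore] -/
theorem Ioo_subset_iUnion_shell (hc : 1 < c) :
    Ioo (0 : ℝ) 1 ⊆ ⋃ k : ℕ, Ioc ((c ^ 2) ^ (k + 1))⁻¹ ((c ^ 2) ^ k)⁻¹ := by
  intro t ht
  have hc2 : 1 < c ^ 2 := one_lt_pow₀ hc two_ne_zero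
  obtain ⟨n, hn1, hn2⟩ := exists_mem_Ioc_zpow ht.1 hc2
  have hn : n + 1 ≤ 0 := by
    by_contra hcon
    have h1 : (1 : ℝ) ≤ (c ^ 2) ^ n := one_le_zpow₀ hc2.le (by omega)
    exact absurd (h1.trans_lt (hn1.trans ht.2)) (lt_irrefl _)
  obtain ⟨k, hk⟩ : ∃ k : ℕ, n + 1 = -(k : ℤ) := ⟨(-(n + 1)).toNat, by omega⟩
  refine mem_iUnion.2 ⟨k, ?_, ?_⟩
  · have : (c ^ 2) ^ n = ((c ^ 2) ^ (k + 1))⁻¹ := by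
      rw [show n = -(((k + 1 : ℕ) : ℤ)) by push_cast; omega, zpow_neg, zpow_natCast]
    rw [← this]; exact hn1
  · have : (c ^ 2) ^ (n + 1) = ((c ^ 2) ^ k)⁻¹ := by
      rw [hk, zpow_neg, zpow_natCast]
    rw [← this]; exact hn2

/-- **`π ∈ L^{3/2}` on the unit cylinder `(0,1) × B₁` up to `t = 0`** (the module docstring's gap
argument: sum of the shell estimates, a geometric series of ratio `λ⁻¹ < 1`). [cite: BradshawTsai2017AHP, §4 (proof of Thm 1.2)] -/
theorem IsAnsatzSolution.setLIntegral_unitCylinder_three_halves_lt_top (h : IsAnsatzSolution c v₀ v π)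
    (hc : 1 < c) :
    ∫⁻ z in Ioo 0 1 ×ˢ ball (0 : ℝ³) 1, ‖π z.1 z.2‖ₑ ^ (3 / 2 : ℝ) < ⊤ := by
  have hc0 : 0 < c := zero_lt_one.trans hc
  set A := ∫⁻ z in Ioc (c ^ 2)⁻¹ 1 ×ˢ (univ : Set ℝ³), ‖π z.1 z.2‖ₑ ^ (5 / 3 : ℝ) with hA
  have hAtop : A < ⊤ := h.setLIntegral_Ioc_five_thirds_lt_top hc
  set r : ℝ≥0∞ := ENNReal.ofReal c⁻¹ with hr
  have hr1 : r < 1 := by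
    rw [hr, ← ENNReal.ofReal_one]
    exact (ENNReal.ofReal_lt_ofReal_iff zero_lt_one).2 (inv_lt_one_of_one_lt₀ hc)
  have hcover : Ioo (0 : ℝ) 1 ×ˢ ball (0 : ℝ³) 1 ⊆
      ⋃ k : ℕ, Ioc ((c ^ 2) ^ (k + 1))⁻¹ ((c ^ 2) ^ k)⁻¹ ×ˢ ball (0 : ℝ³) 1 := by
    rw [← iUnion_prod_const]
    exact prod_mono (Ioo_subset_iUnion_shell hc) Subset.rfl
  calc ∫⁻ z in Ioo 0 1 ×ˢ ball (0 : ℝ³) 1, ‖π z.1 z.2‖ₑ ^ (3 / 2 : ℝ)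
      ≤ ∫⁻ z in ⋃ k : ℕ, Ioc ((c ^ 2) ^ (k + 1))⁻¹ ((c ^ 2) ^ k)⁻¹ ×ˢ ball (0 : ℝ³) 1,
          ‖π z.1 z.2‖ₑ ^ (3 / 2 : ℝ) := lintegral_mono_set hcover
    _ ≤ ∑' k : ℕ, ∫⁻ z in Ioc ((c ^ 2) ^ (k + 1))⁻¹ ((c ^ 2) ^ k)⁻¹ ×ˢ ball (0 : ℝ³) 1,
          ‖π z.1 z.2‖ₑ ^ (3 / 2 : ℝ) := lintegral_iUnion_le _ _
    _ ≤ ∑' k : ℕ, r ^ k * (A + volume (ball (0 : ℝ³) 1)) :=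
        ENNReal.tsum_le_tsum fun k => h.setLIntegral_shell_le hc k
    _ = (∑' k : ℕ, r ^ k) * (A + volume (ball (0 : ℝ³) 1)) := ENNReal.tsum_mul_right
    _ < ⊤ := ENNReal.mul_lt_top (tsum_geometric_lt_top.2 hr1)
        (ENNReal.add_lt_top.2 ⟨hAtop, measure_ball_lt_top⟩)

/-- **`π ∈ L^{3/2}_loc(ℝ³ × [0,∞))`** for an ansatz pair ([BT1] Def. 1.1, first bullet; obtained
from the printed class `p ∈ L^{5/3}(ℝ³ × [0,T])` by the gap argument of the module docstring and
the transport along the scaling, `BradshawTsai2019.setLIntegral_enorm_rpow_lt_top_of_dss`). [cite: BradshawTsai2017AHP, §4 (proof of Thm 1.2)] -/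
theorem IsAnsatzSolution.pressure (h : IsAnsatzSolution c v₀ v π) (hc : 1 < c) (T : ℝ)
    {K : Set ℝ³} (hK : IsCompact K) :
    ∫⁻ z in Ioo 0 T ×ˢ K, ‖π z.1 z.2‖ₑ ^ (3 / 2 : ℝ) < ⊤ :=
  BradshawTsai2019.setLIntegral_enorm_rpow_lt_top_of_dss hc h.dss_pressure zero_lt_one
    (by norm_num) (h.setLIntegral_unitCylinder_three_halves_lt_top hc) hK T

end BradshawTsai2017

end Literature.Analysis.FluidPDE

end
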